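import Summits.AtomisticToContinuum.Crystallization.Theorems.SlackRigidity.Negative.WitnessBasics
import Summits.AtomisticToContinuum.Crystallization.Theorems.PricedLinkCensusChargedPeriodicIsOptimalPacking

/-!
# `KeplerBound` (stmt-AtomisticToContinuum-11961) from bulk rigidity, IIa: uniform Lennard-Jones
# tails over separated configurations

Support file for the item `ThreeConeCertificate.KeplerBound`.  Two elementary floors for ONE
finite configuration `x : Fin N → ℝ³` of `r`-separated points and one particle `i`, used by the
energy arguments `BulkDefectVanish → KeplerBound` and "periodic local limits are minimisers":

* `sum_lennardJones_far_ge`: the far Lennard-Jones terms sum to `≥ −(1/6) ρ⁻¹ · 250 r⁻⁵`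
  (uniformly in `N`), from `V_LJ ≥ −r⁻⁶/6` and the far sixth-power sum
  `ChargedPeriodicOptimal.sum_inv_pow_six_far_le` of the tree (shell sum with exponent five);
* `siteEnergy_lennardJones_ge`: the crude floor `siteEnergy V_LJ x i ≥ −(250/6) r⁻⁶`
  (tree shell sum `sum_inv_pow_six_le`).

All `[folklore]`.
-/

noncomputable section

open scoped BigOperators Topology
open Filter Set Metric

namespace Summit.AtomisticToContinuum.Crystallization.Theorems.KeplerBoundBulk

open Literature.MathematicalPhysics.StatisticalMechanics
open Summit.AtomisticToContinuum.Crystallization.Theorems.SlackRigidityNegative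

/-- **The far Lennard-Jones terms are almost non-negative**: in an `r`-separated configuration,
for `ρ > 0`, `Σ_{k ≠ i, |x i − x k| > ρ} V_LJ(|x i − x k|) ≥ −(1/6) ρ⁻¹ · 250 r⁻⁵`
(`V_LJ ≥ −r⁻⁶/6` termwise, and the far sixth-power sum is `≤ 250 r⁻⁵ ρ⁻¹`). [folklore] -/
theorem sum_lennardJones_far_ge {N : ℕ} (x : Fin N → E3) {r : ℝ} (hr : 0 < r)
    (hsep : ∀ k l, k ≠ l → r ≤ dist (x k) (x l)) (i : Fin N) {ρ : ℝ} (hρ : 0 < ρ) :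
    -(1 / 6 * (ρ⁻¹ * (250 * r⁻¹ ^ 5))) ≤
      ∑ k ∈ (Finset.univ.erase i).filter (fun k => ρ < dist (x i) (x k)),
        lennardJones (dist (x i) (x k)) := by
  -- the far sixth-power sum over the strict far set is below the one over the weak far set
  have h6 : ∑ k ∈ (Finset.univ.erase i).filter (fun k => ρ < dist (x i) (x k)),
      (dist (x i) (x k))⁻¹ ^ 6 ≤ ρ⁻¹ * (250 * r⁻¹ ^ 5) :=
    calc ∑ k ∈ (Finset.univ.erase i).filter (fun k => ρ < dist (x i) (x k)), (dist (x i) (x k))⁻¹ ^ 6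
        ≤ ∑ k ∈ (Finset.univ.erase i).filter (fun k => ρ ≤ dist (x i) (x k)),
            (dist (x i) (x k))⁻¹ ^ 6 :=
          Finset.sum_le_sum_of_subset_of_nonneg
            (fun k hk => Finset.mem_filter.2
              ⟨(Finset.mem_filter.1 hk).1, (Finset.mem_filter.1 hk).2.le⟩)
            fun k _ _ => by positivity
      _ ≤ 250 * r⁻¹ ^ 5 * ρ⁻¹ := ChargedPeriodicOptimal.sum_inv_pow_six_far_le x hr hsep i hρ
      _ = ρ⁻¹ * (250 * r⁻¹ ^ 5) := by ring
  have hterm : ∀ k ∈ (Finset.univ.erase i).filter (fun k => ρ < dist (x i) (x k)),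
      -(1 / 6 * (dist (x i) (x k))⁻¹ ^ 6) ≤ lennardJones (dist (x i) (x k)) := fun k hk =>
    neg_le_lennardJones_of_le (hρ.trans (Finset.mem_filter.1 hk).2) le_rfl
  calc -(1 / 6 * (ρ⁻¹ * (250 * r⁻¹ ^ 5)))
      ≤ -(1 / 6 * ∑ k ∈ (Finset.univ.erase i).filter (fun k => ρ < dist (x i) (x k)),
          (dist (x i) (x k))⁻¹ ^ 6) := by linarith
    _ = ∑ k ∈ (Finset.univ.erase i).filter (fun k => ρ < dist (x i) (x k)),
          -(1 / 6 * (dist (x i) (x k))⁻¹ ^ 6) := by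
        rw [Finset.mul_sum, ← Finset.sum_neg_distrib]
    _ ≤ _ := Finset.sum_le_sum hterm

/-- **Crude floor for site energies**: in an `r`-separated configuration every site energy is
`≥ −(250/6) r⁻⁶` (`V_LJ ≥ −r⁻⁶/6` termwise and the shell sum `sum_inv_pow_six_le`). [folklore] -/
theorem siteEnergy_lennardJones_ge {N : ℕ} (x : Fin N → E3) {r : ℝ} (hr : 0 < r)
    (hsep : ∀ k l, k ≠ l → r ≤ dist (x k) (x l)) (i : Fin N) :
    -(1 / 6 * (250 * r⁻¹ ^ 6)) ≤ siteEnergy lennardJones x i := by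
  have h6 := sum_inv_pow_six_le x hr hsep i
  have hterm : ∀ k ∈ Finset.univ.erase i,
      -(1 / 6 * (dist (x i) (x k))⁻¹ ^ 6) ≤ lennardJones (dist (x i) (x k)) := fun k hk =>
    neg_le_lennardJones_of_le (hr.trans_le (hsep i k (Finset.ne_of_mem_erase hk).symm)) le_rfl
  unfold siteEnergy
  calc -(1 / 6 * (250 * r⁻¹ ^ 6))
      ≤ -(1 / 6 * ∑ k ∈ Finset.univ.erase i, (dist (x i) (x k))⁻¹ ^ 6) := by linarith
    _ = ∑ k ∈ Finset.univ.erase i, -(1 / 6 * (dist (x i) (x k))⁻¹ ^ 6) := by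
        rw [Finset.mul_sum, ← Finset.sum_neg_distrib]
    _ ≤ _ := Finset.sum_le_sum hterm

end Summit.AtomisticToContinuum.Crystallization.Theorems.KeplerBoundBulk

end
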